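import Literature.Analysis.OperatorTheory.DeflatedFormBound

/-!
# The cluster Kato–Temple bound: Ritz values of a trial space plus a min–max a-priori bound enclose a cluster

Topic `Analysis/OperatorTheory`; theorems only (no definition, no named fact, no instance).  Companion of
`DeflatedFormBound.lean` (same operator-free language: a real vector space `D`, a positive semidefinite symmetric
bilinear form `ip` and a symmetric bilinear form `E`) and of `KatoTempleInequality.lean` / `TempleInequality.lean`
(one trial vector).  Everything is written for the TOP of the spectrum (transfer operators: the largest values are the
physical ones); the bottom version is the same statement for `-E`.

**Setting.**  `u₀ … u_{n-1} ∈ D` are `ip`-orthonormal trial vectors with *Ritz data* `m_i` and *residual representers*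
`r_i`: `E(u_i, y) = m_i ip(u_i, y) + ip(r_i, y)` for all `y` and `ip(r_i, u_l) = 0` (for the Ritz vectors of an
`ip`-symmetric operator `K` take `r_i = K u_i − m_i u_i`; then `E(u_i,u_l) = m_i δ_il`, i.e. the `u_i` diagonalise the
Rayleigh–Ritz matrix and `m_i` are the Ritz values); the *residual Gram bound* `ip(Σ c_i r_i, Σ c_i r_i) ≤ ϱ Σ c_i²`
(`ϱ = ‖(1 − P)KP‖²`, implied by the variance bound `‖Ks‖²‖s‖² − ⟨s,Ks⟩² ≤ ϱ‖s‖⁴` on the trial space,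
`residualGram_le_of_variance`); and the *a-priori bound* in MIN–MAX form: there are `n` constraint vectors `χ_l`
(ANY vectors — typically unknown exact eigenvectors, or whatever a coarse argument provides) with `E(y,y) ≤ θ ip(y,y)`
for all `y ⊥ χ`, where `θ < m_i` for all `i` — i.e. "`λ_n ≤ θ < min Ritz`", the hypothesis `ρ ≤ λ_{n+1}` (counting
from 1) of the Lehmann–Maehly–Goerisch method, NOT the stronger "`E ≤ θ` on the complement of the trial space" of
`DeflatedFormBound`.

**Main theorem** (`clusterKatoTemple`).  For every `j` and every `x` which is `ip`-orthogonal to `u_i`, `i < j`: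
`E(x,x) ≤ (m̄_j + ϱ/(m̲ − θ)) · ip(x,x)`, where `m̄_j ≥ m_i` for `i ≥ j` and `m̲ ≤ m_i` for all `i` (`m̲ > θ`).  Read with the
Courant–Fischer characterisation `λ_j = inf_{j constraints} sup_{⊥} E/ip` (constraints `u₀ … u_{j−1}`): the `j`-th
min–max value from the top satisfies `m_j ≤ λ_j ≤ m_j + ϱ/(m_{n−1} − θ)` — the error is QUADRATIC in the residual and
robust inside a cluster (only the gap between the whole cluster of Ritz values and `θ` enters).  For `n = 1` this is
Kato's upper bound `λ₀ ≤ m + ε²/(m − θ)` given `λ₁ ≤ θ < m` [cite: Kato1949, Lemma 2 and Thm 1 (eq. (11))], i.e.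
Temple's inequality mirrored to the top [cite: ReedSimonIV1978, Thm. XIII.5]; for general `n` it is the Kato–Temple form
of the Lehmann–Maehly(–Goerisch) cluster bound with a-priori information `ρ ≤ λ_{n+1}` [cite: Lehmann1963]
[cite: Wunderlich2022, Thm. 6.8 with (6.19) (Lehmann–Goerisch, real form-language version)].  `clusterKatoTemple_of_forall_gt`
takes the a-priori bound in infimum form (`∀ θ' > θ ∃ χ …`, which is what `inf sup ≤ θ` literally says).
`exists_orthonormal_formDiagonal` supplies the input shape: if the Gram matrix of a trial family `v` is positive definite,
its span has an `ip`-orthonormal `E`-diagonal basis (Rayleigh–Ritz eigenbasis) [cite: GolubVanLoan2013, §8.7.1, Cor. 8.7.2].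

**Proof (elementary, no spectral theorem).**  With `q = E − θ·ip`: (i) inertia count (`form_nonpos_of_qOrthogonal`):
`q ≤ 0` on the joint kernel of `n` functionals and `q(u_i,u_l) = (m_i − θ)δ_il > 0`-diagonal force `q(y,y) ≤ 0` for every
`y` that is `q`-orthogonal to all `u_i` (a non-trivial combination of `u₀ … u_{n−1}, y` satisfies the `n` constraints, by
rank–nullity); (ii) with the explicit `q`-projection `p = Σ q(u_i,x)/(m_i−θ) · u_i` of `x` onto the trial space,
`q(x,x) = q(p,p) + q(x−p,x−p) ≤ q(p,p) = Σ ((m_i−θ)a_i + b_i)²/(m_i−θ)` (`a_i = ip(u_i,x)`, `b_i = ip(r_i,x)`); (iii)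
`Σ b_i² ≤ ϱ·ip(w,w)` for `w = x − Σ a_i u_i` (dual form of the residual Gram bound, Cauchy–Schwarz for `ip`) and
`ip(x,x) = Σ a_i² + ip(w,w)` (Bessel); (iv) weighted Cauchy–Schwarz and `2√(PQ) ≤ P + Q`.

Use (cell `ym-beyond`, crux RED `RunningReduction`, idea card `kato-temple-precision-transfer`, door `KatoTempleDoor`):
`ip = l2`, `E = qform`, `u` = `l2`-orthonormalised dressed Ritz functions, `θ` from a precision-free coarse bound
`levelValue (k+1) ≤ θ` (`CoarseNoIntruder`), `ϱ` from the two-step form (variance clause of `DressedRitz`); the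
conclusion feeds `levelValue_le_of_forall_rayleigh_le` with the constraints `u₀ … u_{j−1}`.

## References
* T. Kato, *On the upper and lower bounds of eigenvalues*, J. Phys. Soc. Japan 4 (1949) 334–339 [Kato1949].
* N. J. Lehmann, *Optimale Eigenwerteinschließungen*, Numer. Math. 5 (1963) 246–272 [Lehmann1963].
* J. M. Wunderlich, *Computer-assisted Existence Proofs for Navier–Stokes Equations on an Unbounded Strip with Obstacle*,
  Dissertation, KIT (2022), Thm. 6.8 (Lehmann–Goerisch) and (6.19) [Wunderlich2022].
* M. Reed, B. Simon, *Methods of Modern Mathematical Physics IV* (1978), Thm. XIII.5 [ReedSimonIV1978].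
-/

noncomputable section

open Finset Filter
open scoped BigOperators Topology

namespace Literature.Analysis.OperatorTheory.ClusterKatoTemple

variable {D : Type*} [AddCommGroup D] [Module ℝ D]

/-- Cauchy–Schwarz for a positive semidefinite symmetric bilinear form (from the discriminant). [folklore] -/
private theorem bilin_sq_le (B : D →ₗ[ℝ] D →ₗ[ℝ] ℝ) (hsymm : ∀ x y, B x y = B y x)
    (hpos : ∀ x, 0 ≤ B x x) (x y : D) : (B x y) ^ 2 ≤ B x x * B y y := by
  have hquad : ∀ t : ℝ, 0 ≤ B y y * (t * t) + 2 * B x y * t + B x x := by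
    intro t
    have h := hpos (x + t • y)
    have e : B (x + t • y) (x + t • y) = B y y * (t * t) + 2 * B x y * t + B x x := by
      simp only [map_add, map_smul, LinearMap.add_apply, LinearMap.smul_apply, smul_eq_mul, hsymm y x]
      ring
    rwa [e] at h
  have hd := discrim_le_zero hquad
  rw [discrim] at hd
  nlinarith [hd]

/-- **Inertia count.**  A symmetric bilinear form `q` which is `≤ 0` on the joint kernel of `n` linear functionals and
has a positive diagonal `q(u_i,u_l) = μ_i δ_il`, `μ_i > 0`, on `n` vectors `u_i` is `≤ 0` on every vector that is
`q`-orthogonal to all `u_i` ("at most `n` positive directions").  Proof: rank–nullity gives a non-trivial combination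
`z = Σ c_i u_i + d·y` annihilated by the `n` functionals; `q(z,z) = Σ c_i² μ_i + d² q(y,y) ≤ 0` forces `d ≠ 0` and
`q(y,y) ≤ 0`. [folklore] -/
private theorem form_nonpos_of_qOrthogonal {n : ℕ} (q : D →ₗ[ℝ] D →ₗ[ℝ] ℝ) (hq : ∀ x y, q x y = q y x)
    (f : Fin n → D →ₗ[ℝ] ℝ) (hneg : ∀ y, (∀ l, f l y = 0) → q y y ≤ 0)
    (u : Fin n → D) (μ : Fin n → ℝ) (hμ : ∀ i, 0 < μ i)
    (hdiag : ∀ i l, q (u i) (u l) = if i = l then μ i else 0)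
    (y : D) (hy : ∀ i, q (u i) y = 0) : q y y ≤ 0 := by
  classical
  -- the `n × (n+1)` matrix of the functionals on `(u₀, …, u_{n-1}, y)` has a kernel vector
  have hker : LinearMap.ker (Matrix.mulVecLin
      (Matrix.of fun (l : Fin n) (k : Fin (n + 1)) => f l ((Fin.snoc u y : Fin (n + 1) → D) k))) ≠ ⊥ := by
    apply LinearMap.ker_ne_bot_of_finrank_lt
    simp only [Module.finrank_fin_fun]
    omega
  obtain ⟨g, hg, hg0⟩ := (Submodule.ne_bot_iff _).mp hker
  rw [LinearMap.mem_ker, Matrix.mulVecLin_apply] at hg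
  -- the combination `z = Σ_i g_i u_i + g_n y`
  have hzsum : (∑ k : Fin (n + 1), g k • (Fin.snoc u y : Fin (n + 1) → D) k)
      = (∑ i : Fin n, g (Fin.castSucc i) • u i) + g (Fin.last n) • y := by
    rw [Fin.sum_univ_castSucc]
    simp only [Fin.snoc_castSucc, Fin.snoc_last]
  have hfz : ∀ l, f l ((∑ i : Fin n, g (Fin.castSucc i) • u i) + g (Fin.last n) • y) = 0 := by
    intro l
    have h := congr_fun hg l
    rw [Pi.zero_apply, Matrix.mulVec, dotProduct] at h
    rw [← hzsum, map_sum]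
    simp only [map_smul, smul_eq_mul]
    calc ∑ k, g k * f l ((Fin.snoc u y : Fin (n + 1) → D) k)
        = ∑ k, (Matrix.of fun (l : Fin n) (k : Fin (n + 1)) => f l ((Fin.snoc u y : Fin (n + 1) → D) k)) l k
            * g k := by
          refine sum_congr rfl fun k _ => ?_
          rw [Matrix.of_apply]
          ring
      _ = 0 := h
  have hqz := hneg _ (hfz)
  -- expand `q z z`
  have hqsy : q (∑ i : Fin n, g (Fin.castSucc i) • u i) y = 0 := by
    rw [bilin_sum_smul_left]
    exact sum_eq_zero fun i _ => by rw [hy i, mul_zero]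
  have hqss : q (∑ i : Fin n, g (Fin.castSucc i) • u i) (∑ i : Fin n, g (Fin.castSucc i) • u i)
      = ∑ i : Fin n, g (Fin.castSucc i) ^ 2 * μ i := by
    rw [bilin_sum_smul_sum_smul]
    refine sum_congr rfl fun i _ => ?_
    simp only [hdiag, mul_ite, mul_zero, Finset.sum_ite_eq, Finset.mem_univ, if_true]
    ring
  have hqzz : q ((∑ i : Fin n, g (Fin.castSucc i) • u i) + g (Fin.last n) • y)
      ((∑ i : Fin n, g (Fin.castSucc i) • u i) + g (Fin.last n) • y)
      = ∑ i : Fin n, g (Fin.castSucc i) ^ 2 * μ i + g (Fin.last n) ^ 2 * q y y := by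
    simp only [map_add, map_smul, LinearMap.add_apply, LinearMap.smul_apply, smul_eq_mul]
    rw [hq y, hqsy, hqss]
    ring
  rw [hqzz] at hqz
  have hsum_nonneg : 0 ≤ ∑ i : Fin n, g (Fin.castSucc i) ^ 2 * μ i :=
    sum_nonneg fun i _ => mul_nonneg (sq_nonneg _) (hμ i).le
  by_cases hd0 : g (Fin.last n) = 0
  · -- then all coefficients vanish: contradiction with `g ≠ 0`
    exfalso
    have hsum0 : ∑ i : Fin n, g (Fin.castSucc i) ^ 2 * μ i = 0 := by
      refine le_antisymm ?_ hsum_nonneg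
      have : ∑ i : Fin n, g (Fin.castSucc i) ^ 2 * μ i + g (Fin.last n) ^ 2 * q y y ≤ 0 := hqz
      rw [hd0] at this
      simpa using this
    have hc0 : ∀ i : Fin n, g (Fin.castSucc i) = 0 := by
      intro i
      have h := (sum_eq_zero_iff_of_nonneg (fun i _ => mul_nonneg (sq_nonneg (g (Fin.castSucc i))) (hμ i).le)).mp
        hsum0 i (mem_univ _)
      rcases mul_eq_zero.mp h with h | h
      · exact (pow_eq_zero_iff two_ne_zero).mp h
      · exact absurd h (hμ i).ne'
    apply hg0
    funext k
    rw [Pi.zero_apply]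
    rcases Fin.eq_castSucc_or_eq_last k with ⟨i, rfl⟩ | rfl
    · exact hc0 i
    · exact hd0
  · have hd2 : 0 < g (Fin.last n) ^ 2 := lt_of_le_of_ne (sq_nonneg _) (Ne.symm (pow_ne_zero 2 hd0))
    by_contra hyy
    push Not at hyy
    have : 0 < g (Fin.last n) ^ 2 * q y y := mul_pos hd2 hyy
    linarith
set_option maxHeartbeats 400000 in -- buildfix (bf3-g25): 160k/180k FAIL, 200k PASS at accept time; line-neutral budget line
/-- **Cluster Kato–Temple bound, a-priori information by linear functionals.**  The engine behind `clusterKatoTemple`: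
the a-priori bound `E ≤ θ·ip` is only required on the joint kernel of `n` ARBITRARY linear functionals `f_l : D → ℝ`
(constraints need not be representable by vectors of `D` — e.g. `D` a space of admissible test functions and
`f_l = ip(χ_l, ·)` for constraint vectors `χ_l` outside `D`).  Conclusion as in `clusterKatoTemple`.
[cite: Lehmann1963] [cite: Wunderlich2022, Thm. 6.8 with (6.19) (Lehmann–Goerisch); Kato–Temple coarsening, mirrored
to the top] [cite: Kato1949, Lemma 2, Thm 1 (n = 1)] -/
theorem clusterKatoTemple_of_functionals (ip E : D →ₗ[ℝ] D →ₗ[ℝ] ℝ)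
    (hip_symm : ∀ x y, ip x y = ip y x) (hip_nonneg : ∀ x, 0 ≤ ip x x) (hE_symm : ∀ x y, E x y = E y x)
    {n : ℕ} {θ : ℝ} (f : Fin n → D →ₗ[ℝ] ℝ) (hθ : ∀ y, (∀ l, f l y = 0) → E y y ≤ θ * ip y y)
    (u r : Fin n → D) (m : Fin n → ℝ)
    (hon : ∀ i l, ip (u i) (u l) = if i = l then 1 else 0)
    (hrepr : ∀ i y, E (u i) y = m i * ip (u i) y + ip (r i) y)
    (hru : ∀ i l, ip (r i) (u l) = 0)
    (hθm : ∀ i, θ < m i)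
    {ϱ : ℝ} (hϱ : 0 ≤ ϱ) (hres : ∀ c : Fin n → ℝ, ∑ i, ∑ l, c i * c l * ip (r i) (r l) ≤ ϱ * ∑ i, c i ^ 2)
    {j : ℕ} {mhi mlo : ℝ} (hθlo : θ < mlo) (hlohi : mlo ≤ mhi) (hmlo : ∀ i, mlo ≤ m i)
    (hmhi : ∀ i : Fin n, j ≤ i.val → m i ≤ mhi)
    (x : D) (hx : ∀ i : Fin n, i.val < j → ip (u i) x = 0) :
    E x x ≤ (mhi + ϱ / (mlo - θ)) * ip x x := by
  classical
  -- the shifted form `q = E - θ ip`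
  set q : D →ₗ[ℝ] D →ₗ[ℝ] ℝ := E - θ • ip with hq_def
  have hq : ∀ x y, q x y = E x y - θ * ip x y := fun x y => by
    simp only [hq_def, LinearMap.sub_apply, LinearMap.smul_apply, smul_eq_mul]
  have hq_symm : ∀ x y, q x y = q y x := fun x y => by rw [hq, hq, hE_symm, hip_symm]
  have hμ : ∀ i, 0 < m i - θ := fun i => sub_pos.mpr (hθm i)
  have hqdiag : ∀ i l, q (u i) (u l) = if i = l then m i - θ else 0 := by
    intro i l
    rw [hq, hrepr, hru, hon]
    split_ifs <;> ring
  -- coefficients `a_i = ip(u_i,x)`, `b_i = ip(r_i,x)` and `q(u_i,x) = (m_i-θ) a_i + b_i`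
  have hqux : ∀ i, q (u i) x = (m i - θ) * ip (u i) x + ip (r i) x := by
    intro i
    rw [hq, hrepr]
    ring
  -- the `q`-projection `p` of `x` onto the trial space and the remainder `y = x - p`
  set d : Fin n → ℝ := fun i => ip (u i) x + ip (r i) x / (m i - θ) with hd_def
  have hdq : ∀ i, (m i - θ) * d i = q (u i) x := by
    intro i
    rw [hqux]
    simp only [hd_def]
    rw [mul_add, ← mul_div_assoc, mul_div_cancel_left₀ _ (hμ i).ne']
  set p : D := ∑ i, d i • u i with hp_def
  have hqup : ∀ i, q (u i) p = (m i - θ) * d i := by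
    intro i
    rw [hp_def, bilin_sum_smul_right]
    simp only [hqdiag, mul_ite, mul_zero, Finset.sum_ite_eq, Finset.mem_univ, if_true]
    ring
  have hquy : ∀ i, q (u i) (x - p) = 0 := by
    intro i
    rw [map_sub, hqup, hdq, sub_self]
  -- (i) inertia: `q(y,y) ≤ 0`
  have hqyy : q (x - p) (x - p) ≤ 0 :=
    form_nonpos_of_qOrthogonal q hq_symm f
      (fun z hz => by have h := hθ z hz; rw [hq]; linarith) u (fun i => m i - θ) hμ hqdiag (x - p) hquy
  -- (ii) `q(x,x) = q(p,p) + q(y,y) ≤ q(p,p) = Σ (m_i-θ) d_i²`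
  have hqpy : q p (x - p) = 0 := by
    rw [hp_def, bilin_sum_smul_left]
    exact sum_eq_zero fun i _ => by rw [hquy i, mul_zero]
  have hqpp : q p p = ∑ i, (m i - θ) * d i ^ 2 := by
    rw [hp_def, bilin_sum_smul_sum_smul]
    refine sum_congr rfl fun i _ => ?_
    simp only [hqdiag, mul_ite, mul_zero, Finset.sum_ite_eq, Finset.mem_univ, if_true]
    ring
  have hqxx : q x x = q p p + q (x - p) (x - p) := by
    have e : x = p + (x - p) := by abel
    conv_lhs => rw [e]
    simp only [map_add, LinearMap.add_apply]
    rw [hq_symm (x - p) p, hqpy]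
    ring
  have hqxx_le : q x x ≤ ∑ i, (m i - θ) * d i ^ 2 := by
    rw [hqxx, hqpp]
    linarith
  -- (iii) Bessel: `ip x x = Σ a_i² + ip w w`, `w = x - Σ a_i u_i`, and `b_i = ip(r_i, w)`
  set w : D := x - ∑ i, ip (u i) x • u i with hw_def
  have hW : 0 ≤ ip w w := hip_nonneg w
  have hbessel : ip x x = ∑ i, ip (u i) x ^ 2 + ip w w := by
    have e1 : ip x (∑ i, ip (u i) x • u i) = ∑ i, ip (u i) x ^ 2 := by
      rw [bilin_sum_smul_right]
      refine sum_congr rfl fun i _ => ?_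
      rw [hip_symm x (u i)]
      ring
    have e2 : ip (∑ i, ip (u i) x • u i) (∑ i, ip (u i) x • u i) = ∑ i, ip (u i) x ^ 2 := by
      rw [bilin_sum_smul_sum_smul]
      refine sum_congr rfl fun i _ => ?_
      simp only [hon, mul_ite, mul_one, mul_zero, Finset.sum_ite_eq, Finset.mem_univ, if_true]
      ring
    rw [hw_def]
    simp only [map_sub, LinearMap.sub_apply]
    rw [hip_symm (∑ i, ip (u i) x • u i) x, e1, e2]
    ring
  have hbw : ∀ i, ip (r i) x = ip (r i) w := by
    intro i
    rw [hw_def, map_sub, bilin_sum_smul_right]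
    simp only [hru, mul_zero, sum_const_zero, sub_zero]
  -- dual residual bound `Σ b_i² ≤ ϱ ip(w,w)`
  have hB : ∑ i, ip (r i) x ^ 2 ≤ ϱ * ip w w := by
    have h1 : ip (∑ i, ip (r i) x • r i) w = ∑ i, ip (r i) x ^ 2 := by
      rw [bilin_sum_smul_left]
      refine sum_congr rfl fun i _ => ?_
      rw [← hbw]
      ring
    have h2 : ip (∑ i, ip (r i) x • r i) (∑ i, ip (r i) x • r i) ≤ ϱ * ∑ i, ip (r i) x ^ 2 := by
      rw [bilin_sum_smul_sum_smul]
      exact hres _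
    have h3 := bilin_sq_le ip hip_symm hip_nonneg (∑ i, ip (r i) x • r i) w
    rw [h1] at h3
    have hS : 0 ≤ ∑ i, ip (r i) x ^ 2 := sum_nonneg fun i _ => sq_nonneg _
    rcases hS.eq_or_lt with h0 | hpos
    · rw [← h0]
      exact mul_nonneg hϱ hW
    · have h4 : (∑ i, ip (r i) x ^ 2) ^ 2 ≤ (ϱ * ∑ i, ip (r i) x ^ 2) * ip w w :=
        h3.trans (mul_le_mul_of_nonneg_right h2 hW)
      by_contra hcon
      push Not at hcon
      have : (ϱ * ip w w) * ∑ i, ip (r i) x ^ 2 < (∑ i, ip (r i) x ^ 2) * ∑ i, ip (r i) x ^ 2 :=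
        mul_lt_mul_of_pos_right hcon hpos
      nlinarith
  -- (iv) the three sums
  have hA : 0 ≤ ∑ i, ip (u i) x ^ 2 := sum_nonneg fun i _ => sq_nonneg _
  have hT1 : ∑ i, (m i - θ) * ip (u i) x ^ 2 ≤ (mhi - θ) * ∑ i, ip (u i) x ^ 2 := by
    rw [mul_sum]
    refine sum_le_sum fun i _ => ?_
    by_cases hij : i.val < j
    · rw [hx i hij]
      simp
    · exact mul_le_mul_of_nonneg_right (by linarith [hmhi i (not_lt.mp hij)]) (sq_nonneg _)
  have hT3 : ∑ i, ip (r i) x ^ 2 / (m i - θ) ≤ (∑ i, ip (r i) x ^ 2) / (mlo - θ) := by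
    rw [sum_div]
    refine sum_le_sum fun i _ => ?_
    exact div_le_div_of_nonneg_left (sq_nonneg _) (sub_pos.mpr hθlo) (by linarith [hmlo i])
  have hT2 : (∑ i, ip (u i) x * ip (r i) x) ^ 2 ≤ (∑ i, ip (u i) x ^ 2) * ∑ i, ip (r i) x ^ 2 :=
    sum_mul_sq_le_sq_mul_sq _ _ _
  have hexp : ∑ i, (m i - θ) * d i ^ 2 = ∑ i, (m i - θ) * ip (u i) x ^ 2
      + 2 * ∑ i, ip (u i) x * ip (r i) x + ∑ i, ip (r i) x ^ 2 / (m i - θ) := by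
    rw [mul_sum, ← sum_add_distrib, ← sum_add_distrib]
    refine sum_congr rfl fun i _ => ?_
    simp only [hd_def]
    have hne : m i - θ ≠ 0 := (hμ i).ne'
    field_simp
    ring
  -- `2 T ≤ (ϱ/δ) A + δ W` with `δ = mlo - θ`
  have hδ : 0 < mlo - θ := sub_pos.mpr hθlo
  have hcross : 2 * ∑ i, ip (u i) x * ip (r i) x
      ≤ ϱ / (mlo - θ) * ∑ i, ip (u i) x ^ 2 + (mlo - θ) * ip w w := by
    have hPQ : (∑ i, ip (u i) x * ip (r i) x) ^ 2
        ≤ (ϱ / (mlo - θ) * ∑ i, ip (u i) x ^ 2) * ((mlo - θ) * ip w w) := by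
      calc (∑ i, ip (u i) x * ip (r i) x) ^ 2
          ≤ (∑ i, ip (u i) x ^ 2) * ∑ i, ip (r i) x ^ 2 := hT2
        _ ≤ (∑ i, ip (u i) x ^ 2) * (ϱ * ip w w) := mul_le_mul_of_nonneg_left hB hA
        _ = (ϱ / (mlo - θ) * ∑ i, ip (u i) x ^ 2) * ((mlo - θ) * ip w w) := by
          field_simp
    have hP : 0 ≤ ϱ / (mlo - θ) * ∑ i, ip (u i) x ^ 2 := by positivity
    have hQ : 0 ≤ (mlo - θ) * ip w w := by positivity
    nlinarith [sq_nonneg (ϱ / (mlo - θ) * ∑ i, ip (u i) x ^ 2 - (mlo - θ) * ip w w), hPQ, hP, hQ,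
      sq_nonneg (2 * ∑ i, ip (u i) x * ip (r i) x
        - (ϱ / (mlo - θ) * ∑ i, ip (u i) x ^ 2 + (mlo - θ) * ip w w))]
  -- assemble
  have hS : (∑ i, ip (r i) x ^ 2) / (mlo - θ) ≤ ϱ / (mlo - θ) * ip w w := by
    rw [div_mul_eq_mul_div]
    exact div_le_div_of_nonneg_right hB hδ.le
  have hδW : (mlo - θ) * ip w w ≤ (mhi - θ) * ip w w := mul_le_mul_of_nonneg_right (by linarith) hW
  have hfin : q x x ≤ (mhi - θ + ϱ / (mlo - θ)) * (∑ i, ip (u i) x ^ 2 + ip w w) := by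
    have h1 : q x x ≤ (mhi - θ) * ∑ i, ip (u i) x ^ 2 + 2 * ∑ i, ip (u i) x * ip (r i) x
        + (∑ i, ip (r i) x ^ 2) / (mlo - θ) := by linarith [hqxx_le, hexp, hT1, hT3]
    nlinarith [h1, hcross, hS, hδW, hA, hW]
  rw [hq, hbessel] at hfin
  rw [hbessel]
  nlinarith [hfin, hA, hW]

/-- **Cluster Kato–Temple bound (top of the spectrum, min–max a-priori information).**  `ip` positive semidefinite
symmetric, `E` symmetric; `u` `ip`-orthonormal trial vectors with Ritz data `m_i` and residual representers `r_i`
(`E(u_i,·) = m_i ip(u_i,·) + ip(r_i,·)`, `r_i ⊥ u`), residual Gram bound `ϱ ≥ 0`; a-priori bound: `E ≤ θ·ip` on the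
joint `ip`-orthogonal complement of SOME `n` vectors `χ_l`, with `θ < m_i` for all `i`.  Then for every `x`
`ip`-orthogonal to `u_i`, `i < j`: `E(x,x) ≤ (m̄ + ϱ/(m̲ − θ))·ip(x,x)` whenever `m_i ≤ m̄` for `i ≥ j` and
`θ < m̲ ≤ m_i` for all `i` (`m̲ ≤ m̄`).  [cite: Lehmann1963] [cite: Wunderlich2022, Thm. 6.8 with (6.19) (Lehmann–Goerisch);
Kato–Temple coarsening, mirrored to the top] [cite: Kato1949, Lemma 2, Thm 1 (n = 1)] -/
theorem clusterKatoTemple (ip E : D →ₗ[ℝ] D →ₗ[ℝ] ℝ)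
    (hip_symm : ∀ x y, ip x y = ip y x) (hip_nonneg : ∀ x, 0 ≤ ip x x) (hE_symm : ∀ x y, E x y = E y x)
    {n : ℕ} {θ : ℝ} (χ : Fin n → D) (hθ : ∀ y, (∀ l, ip (χ l) y = 0) → E y y ≤ θ * ip y y)
    (u r : Fin n → D) (m : Fin n → ℝ)
    (hon : ∀ i l, ip (u i) (u l) = if i = l then 1 else 0)
    (hrepr : ∀ i y, E (u i) y = m i * ip (u i) y + ip (r i) y)
    (hru : ∀ i l, ip (r i) (u l) = 0)
    (hθm : ∀ i, θ < m i)
    {ϱ : ℝ} (hϱ : 0 ≤ ϱ) (hres : ∀ c : Fin n → ℝ, ∑ i, ∑ l, c i * c l * ip (r i) (r l) ≤ ϱ * ∑ i, c i ^ 2)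
    {j : ℕ} {mhi mlo : ℝ} (hθlo : θ < mlo) (hlohi : mlo ≤ mhi) (hmlo : ∀ i, mlo ≤ m i)
    (hmhi : ∀ i : Fin n, j ≤ i.val → m i ≤ mhi)
    (x : D) (hx : ∀ i : Fin n, i.val < j → ip (u i) x = 0) :
    E x x ≤ (mhi + ϱ / (mlo - θ)) * ip x x :=
  clusterKatoTemple_of_functionals ip E hip_symm hip_nonneg hE_symm (fun l => ip (χ l)) hθ u r m hon hrepr hru
    hθm hϱ hres hθlo hlohi hmlo hmhi x hx

/-- The case without orthogonality constraints (`j = 0`): under the hypotheses of `clusterKatoTemple`,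
`E(x,x) ≤ (m̄ + ϱ/(m̲ − θ)) ip(x,x)` for EVERY `x`, `m̄ = max m_i`, `m̲ = min m_i` — an upper bound for the top of the
spectrum from Ritz data of a whole cluster. [cite: Lehmann1963] [cite: Wunderlich2022, Thm. 6.8 with (6.19)] -/
theorem clusterKatoTemple_top (ip E : D →ₗ[ℝ] D →ₗ[ℝ] ℝ)
    (hip_symm : ∀ x y, ip x y = ip y x) (hip_nonneg : ∀ x, 0 ≤ ip x x) (hE_symm : ∀ x y, E x y = E y x)
    {n : ℕ} {θ : ℝ} (χ : Fin n → D) (hθ : ∀ y, (∀ l, ip (χ l) y = 0) → E y y ≤ θ * ip y y)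
    (u r : Fin n → D) (m : Fin n → ℝ)
    (hon : ∀ i l, ip (u i) (u l) = if i = l then 1 else 0)
    (hrepr : ∀ i y, E (u i) y = m i * ip (u i) y + ip (r i) y)
    (hru : ∀ i l, ip (r i) (u l) = 0)
    {ϱ : ℝ} (hϱ : 0 ≤ ϱ) (hres : ∀ c : Fin n → ℝ, ∑ i, ∑ l, c i * c l * ip (r i) (r l) ≤ ϱ * ∑ i, c i ^ 2)
    {mhi mlo : ℝ} (hθlo : θ < mlo) (hlohi : mlo ≤ mhi) (hm : ∀ i, mlo ≤ m i ∧ m i ≤ mhi) (x : D) :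
    E x x ≤ (mhi + ϱ / (mlo - θ)) * ip x x :=
  clusterKatoTemple ip E hip_symm hip_nonneg hE_symm χ hθ u r m hon hrepr hru
    (fun i => hθlo.trans_le (hm i).1) hϱ hres (j := 0) hθlo hlohi (fun i => (hm i).1) (fun i _ => (hm i).2) x
    (fun _ hi => absurd hi (Nat.not_lt_zero _))

/-- **Kato's upper bound / Temple's inequality at the top, min–max form (`n = 1`).**  One `ip`-normalised trial vector
`v` with Rayleigh value `m = E(v,v)`, residual representer `r ⊥ v` (`E(v,·) = m ip(v,·) + ip(r,·)`) with
`ip(r,r) ≤ ε²`, and ONE vector `χ` with `E ≤ θ ip` on `χ^⊥` (`λ₁ ≤ θ`), `θ < m`: then `E(x,x) ≤ (m + ε²/(m − θ)) ip(x,x)`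
for all `x`, i.e. `λ₀ ≤ m + ε²/(m − θ)`. [cite: Kato1949, Lemma 2, Thm 1] [cite: ReedSimonIV1978, Thm. XIII.5] -/
theorem katoTemple_top (ip E : D →ₗ[ℝ] D →ₗ[ℝ] ℝ)
    (hip_symm : ∀ x y, ip x y = ip y x) (hip_nonneg : ∀ x, 0 ≤ ip x x) (hE_symm : ∀ x y, E x y = E y x)
    {θ : ℝ} (χ : D) (hθ : ∀ y, ip χ y = 0 → E y y ≤ θ * ip y y)
    (v r : D) {m εsq : ℝ} (hv : ip v v = 1) (hrepr : ∀ y, E v y = m * ip v y + ip r y) (hrv : ip r v = 0)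
    (hθm : θ < m) (hε : 0 ≤ εsq) (hr : ip r r ≤ εsq) (x : D) :
    E x x ≤ (m + εsq / (m - θ)) * ip x x := by
  refine clusterKatoTemple_top ip E hip_symm hip_nonneg hE_symm (n := 1) (fun _ => χ)
    (fun y hy => hθ y (hy 0)) (fun _ => v) (fun _ => r) (fun _ => m)
    (fun i l => by rw [if_pos (Subsingleton.elim i l), hv]) (fun _ y => hrepr y) (fun _ _ => hrv) hε
    (fun c => ?_) hθm le_rfl (fun _ => ⟨le_rfl, le_rfl⟩) x
  simp only [Finset.univ_unique, Fin.default_eq_zero, Finset.sum_singleton]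
  nlinarith [sq_nonneg (c 0), hr, hip_nonneg r]

/-- **A-priori information in infimum form, by linear functionals.**  As `clusterKatoTemple_of_forall_gt`, with the
`n` constraints given by arbitrary linear functionals for each `θ' > θ`. [cite: Lehmann1963]
[cite: Wunderlich2022, Thm. 6.8 with (6.19)] -/
theorem clusterKatoTemple_of_functionals_of_forall_gt (ip E : D →ₗ[ℝ] D →ₗ[ℝ] ℝ)
    (hip_symm : ∀ x y, ip x y = ip y x) (hip_nonneg : ∀ x, 0 ≤ ip x x) (hE_symm : ∀ x y, E x y = E y x)
    {n : ℕ} {θ : ℝ}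
    (hθ : ∀ θ', θ < θ' → ∃ f : Fin n → D →ₗ[ℝ] ℝ, ∀ y, (∀ l, f l y = 0) → E y y ≤ θ' * ip y y)
    (u r : Fin n → D) (m : Fin n → ℝ)
    (hon : ∀ i l, ip (u i) (u l) = if i = l then 1 else 0)
    (hrepr : ∀ i y, E (u i) y = m i * ip (u i) y + ip (r i) y)
    (hru : ∀ i l, ip (r i) (u l) = 0)
    {ϱ : ℝ} (hϱ : 0 ≤ ϱ) (hres : ∀ c : Fin n → ℝ, ∑ i, ∑ l, c i * c l * ip (r i) (r l) ≤ ϱ * ∑ i, c i ^ 2)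
    {j : ℕ} {mhi mlo : ℝ} (hθlo : θ < mlo) (hlohi : mlo ≤ mhi) (hmlo : ∀ i, mlo ≤ m i)
    (hmhi : ∀ i : Fin n, j ≤ i.val → m i ≤ mhi)
    (x : D) (hx : ∀ i : Fin n, i.val < j → ip (u i) x = 0) :
    E x x ≤ (mhi + ϱ / (mlo - θ)) * ip x x := by
  -- for every `θ' ∈ (θ, mlo)` the bound holds with `θ'`; let `θ' ↓ θ`
  have hbound : ∀ θ', θ < θ' → θ' < mlo → E x x ≤ (mhi + ϱ / (mlo - θ')) * ip x x := by
    intro θ' h1 h2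
    obtain ⟨f, hf⟩ := hθ θ' h1
    exact clusterKatoTemple_of_functionals ip E hip_symm hip_nonneg hE_symm f hf u r m hon hrepr hru
      (fun i => h2.trans_le (hmlo i)) hϱ hres h2 hlohi hmlo hmhi x hx
  have hcont : Tendsto (fun t : ℝ => (mhi + ϱ / (mlo - t)) * ip x x) (𝓝[>] θ)
      (𝓝 ((mhi + ϱ / (mlo - θ)) * ip x x)) := by
    have hca : ContinuousAt (fun t : ℝ => (mhi + ϱ / (mlo - t)) * ip x x) θ :=
      ((continuousAt_const.add (continuousAt_const.div (continuousAt_const.sub continuousAt_id)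
        (sub_ne_zero.mpr (ne_of_gt hθlo)))).mul continuousAt_const)
    exact tendsto_nhdsWithin_of_tendsto_nhds hca.tendsto
  have hev : ∀ᶠ t in 𝓝[>] θ, E x x ≤ (mhi + ϱ / (mlo - t)) * ip x x := by
    have h1 : ∀ᶠ t in 𝓝[>] θ, t < mlo := eventually_nhdsWithin_of_eventually_nhds (eventually_lt_nhds hθlo)
    have h2 : ∀ᶠ t in 𝓝[>] θ, θ < t := eventually_nhdsWithin_of_forall fun t ht => ht
    filter_upwards [h1, h2] with t ht1 ht2 using hbound t ht2 ht1
  exact ge_of_tendsto hcont hev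

/-- **A-priori bound in infimum form.**  If for every `θ' > θ` there are `n` constraint vectors with `E ≤ θ'·ip` on their
joint orthogonal complement (this is literally `inf_{n constraints} sup_{⊥} E/ip ≤ θ`, the Courant–Fischer value
`λ_n ≤ θ`), the conclusion of `clusterKatoTemple` holds with `θ` itself. [cite: Lehmann1963]
[cite: Wunderlich2022, Thm. 6.8 with (6.19)] -/
theorem clusterKatoTemple_of_forall_gt (ip E : D →ₗ[ℝ] D →ₗ[ℝ] ℝ)
    (hip_symm : ∀ x y, ip x y = ip y x) (hip_nonneg : ∀ x, 0 ≤ ip x x) (hE_symm : ∀ x y, E x y = E y x)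
    {n : ℕ} {θ : ℝ}
    (hθ : ∀ θ', θ < θ' → ∃ χ : Fin n → D, ∀ y, (∀ l, ip (χ l) y = 0) → E y y ≤ θ' * ip y y)
    (u r : Fin n → D) (m : Fin n → ℝ)
    (hon : ∀ i l, ip (u i) (u l) = if i = l then 1 else 0)
    (hrepr : ∀ i y, E (u i) y = m i * ip (u i) y + ip (r i) y)
    (hru : ∀ i l, ip (r i) (u l) = 0)
    {ϱ : ℝ} (hϱ : 0 ≤ ϱ) (hres : ∀ c : Fin n → ℝ, ∑ i, ∑ l, c i * c l * ip (r i) (r l) ≤ ϱ * ∑ i, c i ^ 2)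
    {j : ℕ} {mhi mlo : ℝ} (hθlo : θ < mlo) (hlohi : mlo ≤ mhi) (hmlo : ∀ i, mlo ≤ m i)
    (hmhi : ∀ i : Fin n, j ≤ i.val → m i ≤ mhi)
    (x : D) (hx : ∀ i : Fin n, i.val < j → ip (u i) x = 0) :
    E x x ≤ (mhi + ϱ / (mlo - θ)) * ip x x :=
  clusterKatoTemple_of_functionals_of_forall_gt ip E hip_symm hip_nonneg hE_symm
    (fun θ' h => by obtain ⟨χ, hχ⟩ := hθ θ' h; exact ⟨fun l => ip (χ l), hχ⟩) u r m hon hrepr hru hϱ hres hθlo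
    hlohi hmlo hmhi x hx

/-! ## Operator language: Ritz vectors of an `ip`-symmetric operator -/

/-- **Cluster Kato–Temple bound for an `ip`-symmetric operator.**  `K` `ip`-symmetric, `u` `ip`-orthonormal with
`ip(u_i, K u_l) = m_i δ_il` (the `u_i` diagonalise the Rayleigh–Ritz matrix of their span, Ritz values `m_i`),
residual Gram bound `ip(Σ c_i (K u_i − m_i u_i), Σ c_i (K u_i − m_i u_i)) ≤ ϱ Σ c_i²` (`ϱ = ‖(1−P)KP‖²`), and
`n` vectors `χ_l` with `ip(y, K y) ≤ θ ip(y,y)` on their joint orthogonal complement, `θ < m̲ ≤ m_i ≤ m̄` (`m_i ≤ m̄` only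
required for `i ≥ j`): every `x ⊥ u₀ … u_{j−1}` has `ip(x, Kx) ≤ (m̄ + ϱ/(m̲ − θ)) ip(x,x)`.
[cite: Lehmann1963] [cite: Wunderlich2022, Thm. 6.8 with (6.19)] [cite: Kato1949, Lemma 2, Thm 1 (n = 1)] -/
theorem clusterKatoTemple_op (ip : D →ₗ[ℝ] D →ₗ[ℝ] ℝ)
    (hip_symm : ∀ x y, ip x y = ip y x) (hip_nonneg : ∀ x, 0 ≤ ip x x)
    (K : D →ₗ[ℝ] D) (hK : ∀ x y, ip (K x) y = ip x (K y))
    {n : ℕ} {θ : ℝ} (χ : Fin n → D) (hθ : ∀ y, (∀ l, ip (χ l) y = 0) → ip y (K y) ≤ θ * ip y y)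
    (u : Fin n → D) (m : Fin n → ℝ)
    (hon : ∀ i l, ip (u i) (u l) = if i = l then 1 else 0)
    (hritz : ∀ i l, ip (u i) (K (u l)) = if i = l then m i else 0)
    (hθm : ∀ i, θ < m i)
    {ϱ : ℝ} (hϱ : 0 ≤ ϱ)
    (hres : ∀ c : Fin n → ℝ,
      ip (∑ i, c i • (K (u i) - m i • u i)) (∑ i, c i • (K (u i) - m i • u i)) ≤ ϱ * ∑ i, c i ^ 2)
    {j : ℕ} {mhi mlo : ℝ} (hθlo : θ < mlo) (hlohi : mlo ≤ mhi) (hmlo : ∀ i, mlo ≤ m i)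
    (hmhi : ∀ i : Fin n, j ≤ i.val → m i ≤ mhi)
    (x : D) (hx : ∀ i : Fin n, i.val < j → ip (u i) x = 0) :
    ip x (K x) ≤ (mhi + ϱ / (mlo - θ)) * ip x x := by
  -- the form `E(x,y) = ip(x, K y)` and the residuals `r_i = K u_i - m_i u_i`
  have hE_apply : ∀ x y, (ip.compl₂ K) x y = ip x (K y) := fun x y => LinearMap.compl₂_apply _ _ _ _
  have hE_symm : ∀ x y, (ip.compl₂ K) x y = (ip.compl₂ K) y x := fun x y => by
    rw [hE_apply, hE_apply, hip_symm x (K y), hK]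
  have hrepr : ∀ i y, (ip.compl₂ K) (u i) y = m i * ip (u i) y + ip (K (u i) - m i • u i) y := by
    intro i y
    rw [hE_apply, ← hK, map_sub, map_smul, LinearMap.sub_apply, LinearMap.smul_apply, smul_eq_mul]
    ring
  have hru : ∀ i l, ip (K (u i) - m i • u i) (u l) = 0 := by
    intro i l
    rw [map_sub, map_smul, LinearMap.sub_apply, LinearMap.smul_apply, smul_eq_mul, hK, hritz, hon]
    split_ifs <;> ring
  have hres' : ∀ c : Fin n → ℝ,
      ∑ i, ∑ l, c i * c l * ip (K (u i) - m i • u i) (K (u l) - m l • u l) ≤ ϱ * ∑ i, c i ^ 2 := by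
    intro c
    rw [← bilin_sum_smul_sum_smul]
    exact hres c
  have h := clusterKatoTemple ip (ip.compl₂ K) hip_symm hip_nonneg hE_symm χ
    (fun y hy => by rw [hE_apply]; exact hθ y hy) u (fun i => K (u i) - m i • u i) m hon hrepr hru hθm hϱ hres'
    hθlo hlohi hmlo hmhi x hx
  rwa [hE_apply] at h

/-- **Variance bound ⇒ residual Gram bound.**  For `ip`-orthonormal `u` diagonalising the Rayleigh–Ritz matrix of an
`ip`-symmetric `K` (`ip(u_i, K u_l) = m_i δ_il`), the variance bound on the trial space
`ip(Ks,Ks)·ip(s,s) − ip(s,Ks)² ≤ ϱ·ip(s,s)²` (`s ∈ span u`) implies the residual Gram bound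
`ip(Σ c_i r_i, Σ c_i r_i) ≤ ϱ Σ c_i²`, `r_i = K u_i − m_i u_i`: indeed `Σ c_i r_i = Ks − Σ c_i m_i u_i` with
`ip(Σ c_i r_i, Σ c_i r_i) = ip(Ks,Ks) − Σ c_i² m_i²` and `(Σ c_i² m_i)² ≤ (Σ c_i²)(Σ c_i² m_i²)`.
[cite: Kato1949, §1 (ε² = (Kw,Kw) − η², the variance of a trial vector)] -/
theorem residualGram_le_of_variance (ip : D →ₗ[ℝ] D →ₗ[ℝ] ℝ)
    (hip_symm : ∀ x y, ip x y = ip y x)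
    (K : D →ₗ[ℝ] D) (hK : ∀ x y, ip (K x) y = ip x (K y))
    {n : ℕ} (u : Fin n → D) (m : Fin n → ℝ)
    (hon : ∀ i l, ip (u i) (u l) = if i = l then 1 else 0)
    (hritz : ∀ i l, ip (u i) (K (u l)) = if i = l then m i else 0)
    {ϱ : ℝ} (hvar : ∀ s ∈ Submodule.span ℝ (Set.range u),
      ip (K s) (K s) * ip s s - ip s (K s) ^ 2 ≤ ϱ * ip s s ^ 2)
    (c : Fin n → ℝ) :
    ip (∑ i, c i • (K (u i) - m i • u i)) (∑ i, c i • (K (u i) - m i • u i)) ≤ ϱ * ∑ i, c i ^ 2 := by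
  classical
  set s : D := ∑ i, c i • u i with hs_def
  have hs_mem : s ∈ Submodule.span ℝ (Set.range u) :=
    Submodule.sum_mem _ fun i _ => Submodule.smul_mem _ _ (Submodule.subset_span (Set.mem_range_self i))
  -- `Σ c_i r_i = K s - v`, `v = Σ (c_i m_i) u_i`
  set v : D := ∑ i, (c i * m i) • u i with hv_def
  have hr : ∑ i, c i • (K (u i) - m i • u i) = K s - v := by
    rw [hs_def, hv_def, map_sum, ← Finset.sum_sub_distrib]
    refine sum_congr rfl fun i _ => ?_
    rw [map_smul, smul_sub, smul_smul]
  -- Gram data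
  have hss : ip s s = ∑ i, c i ^ 2 := by
    rw [hs_def, bilin_sum_smul_sum_smul]
    refine sum_congr rfl fun i _ => ?_
    simp only [hon, mul_ite, mul_one, mul_zero, Finset.sum_ite_eq, Finset.mem_univ, if_true]
    ring
  have hKs : K s = ∑ i, c i • K (u i) := by rw [hs_def, map_sum]; simp only [map_smul]
  have hsKs : ip s (K s) = ∑ i, c i ^ 2 * m i := by
    rw [hKs, hs_def, bilin_sum_smul_sum_smul]
    refine sum_congr rfl fun i _ => ?_
    simp only [hritz, mul_ite, mul_zero, Finset.sum_ite_eq, Finset.mem_univ, if_true]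
    ring
  have hvv : ip v v = ∑ i, (c i * m i) ^ 2 := by
    rw [hv_def, bilin_sum_smul_sum_smul]
    refine sum_congr rfl fun i _ => ?_
    simp only [hon, mul_ite, mul_one, mul_zero, Finset.sum_ite_eq, Finset.mem_univ, if_true]
    ring
  have hKsv : ip (K s) v = ip v v := by
    -- `ip(K s, u_l) = Σ c_i ip(K u_i, u_l) = c_l m_l`
    have hKsu : ∀ l, ip (K s) (u l) = c l * m l := by
      intro l
      rw [hKs, bilin_sum_smul_left]
      simp only [hK, hritz, mul_ite, mul_zero, Finset.sum_ite_eq', Finset.mem_univ, if_true]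
    rw [hvv, hv_def, bilin_sum_smul_right]
    refine sum_congr rfl fun l _ => ?_
    rw [hKsu]
    ring
  have hrr : ip (K s - v) (K s - v) = ip (K s) (K s) - ip v v := by
    simp only [map_sub, LinearMap.sub_apply]
    rw [hip_symm v (K s), hKsv]
    ring
  -- Cauchy–Schwarz in the coefficients: `(Σ c_i² m_i)² ≤ (Σ c_i²)(Σ (c_i m_i)²)`
  have hcs : (∑ i, c i ^ 2 * m i) ^ 2 ≤ (∑ i, c i ^ 2) * ∑ i, (c i * m i) ^ 2 := by
    have h := sum_mul_sq_le_sq_mul_sq (Finset.univ : Finset (Fin n)) c (fun i => c i * m i)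
    have e : ∑ i, c i * (c i * m i) = ∑ i, c i ^ 2 * m i := sum_congr rfl fun i _ => by ring
    rwa [e] at h
  rw [hr, hrr]
  have hσ : 0 ≤ ∑ i, c i ^ 2 := sum_nonneg fun i _ => sq_nonneg _
  rcases hσ.eq_or_lt with h0 | hpos
  · -- `c = 0`
    have hc0 : ∀ i, c i = 0 := fun i => by
      have h := (sum_eq_zero_iff_of_nonneg (fun i _ => sq_nonneg (c i))).mp h0.symm i (mem_univ _)
      exact (pow_eq_zero_iff two_ne_zero).mp h
    have hs0 : s = 0 := by rw [hs_def]; exact sum_eq_zero fun i _ => by rw [hc0 i, zero_smul]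
    have hv0 : v = 0 := by rw [hv_def]; exact sum_eq_zero fun i _ => by rw [hc0 i, zero_mul, zero_smul]
    rw [hs0, hv0, map_zero, ← h0]
    simp
  · have hv := hvar s hs_mem
    rw [hss, hsKs] at hv
    -- `σ · (ip(Ks,Ks) − ip(v,v)) ≤ σ · ip(Ks,Ks) − (Σ c²m)² ≤ ϱ σ²`
    have h1 : (∑ i, c i ^ 2) * (ip (K s) (K s) - ip v v) ≤ ϱ * (∑ i, c i ^ 2) ^ 2 := by
      rw [hvv]
      nlinarith [hv, hcs]
    by_contra hcon
    push Not at hcon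
    have : ϱ * (∑ i, c i ^ 2) * ∑ i, c i ^ 2 < (ip (K s) (K s) - ip v v) * ∑ i, c i ^ 2 :=
      mul_lt_mul_of_pos_right hcon hpos
    nlinarith

/-! ## Ritz diagonalisation of a trial family (the input shape of `clusterKatoTemple`) -/

open scoped Matrix

/-- A bilinear form on two linear combinations of a family `v` is the coefficient pencil
`c ⬝ᵥ (M *ᵥ c')`, `M_{ll'} = B(v_l, v_l')`. [folklore] -/
private theorem bilin_sum_smul_eq_dotProduct_mulVec (B : D →ₗ[ℝ] D →ₗ[ℝ] ℝ) {n : ℕ} (v : Fin n → D)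
    (c c' : Fin n → ℝ) :
    B (∑ l, c l • v l) (∑ l, c' l • v l) = c ⬝ᵥ ((Matrix.of fun l l' => B (v l) (v l')) *ᵥ c') := by
  rw [bilin_sum_smul_sum_smul, dotProduct]
  refine sum_congr rfl fun l _ => ?_
  rw [Matrix.mulVec, dotProduct, mul_sum]
  refine sum_congr rfl fun l' _ => ?_
  rw [Matrix.of_apply]
  ring

/-- For a real symmetric matrix, its orthonormal eigenvectors `W_i` (columns of `eigenvectorUnitary`) satisfy
`W_i ⬝ᵥ W_l = δ_il` and `W_i ⬝ᵥ (M *ᵥ W_l) = m_l δ_il`. [folklore] -/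
private theorem eigenvectorBasis_dotProduct {n : ℕ} {M : Matrix (Fin n) (Fin n) ℝ} (hM : M.IsHermitian)
    (i l : Fin n) :
    (⇑(hM.eigenvectorBasis i) : Fin n → ℝ) ⬝ᵥ ⇑(hM.eigenvectorBasis l) = (if i = l then 1 else 0) ∧
    (⇑(hM.eigenvectorBasis i) : Fin n → ℝ) ⬝ᵥ (M *ᵥ ⇑(hM.eigenvectorBasis l))
      = if i = l then hM.eigenvalues i else 0 := by
  classical
  have hortho := orthonormal_iff_ite.mp hM.eigenvectorBasis.orthonormal i l
  rw [EuclideanSpace.inner_eq_star_dotProduct, star_trivial, dotProduct_comm] at hortho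
  refine ⟨hortho, ?_⟩
  rw [hM.mulVec_eigenvectorBasis l, dotProduct_smul, smul_eq_mul, hortho]
  split_ifs with h
  · subst h; ring
  · ring

/-- **Ritz diagonalisation (simultaneous diagonalisation of the pencil `(E, ip)` on a trial space).**  If the Gram
matrix `G_{il} = ip(v_i, v_l)` of `v₀ … v_{n−1}` is positive definite and `E` is symmetric, there are `u₀ … u_{n−1}` in
the span of the `v_i` which are `ip`-orthonormal and `E`-diagonal: `ip(u_i,u_l) = δ_il`, `E(u_i,u_l) = m_i δ_il` — the
Rayleigh–Ritz eigenbasis of the trial space with Ritz values `m_i`; this is the input shape of `clusterKatoTemple`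
(with `r_i` the representer of `E(u_i,·) − m_i ip(u_i,·)`).  Proof: whiten with the spectral decomposition of `G`, then
diagonalise the whitened form matrix (spectral theorem for real symmetric matrices, twice).
[cite: GolubVanLoan2013, §8.7.1, Cor. 8.7.2 (a symmetric-definite pencil `A − λB` is simultaneously diagonalised by a
congruence `XᵀAX`, `XᵀBX`)] -/
theorem exists_orthonormal_formDiagonal (ip E : D →ₗ[ℝ] D →ₗ[ℝ] ℝ) (hE_symm : ∀ x y, E x y = E y x)
    {n : ℕ} (v : Fin n → D) (hG : (Matrix.of fun i l => ip (v i) (v l)).PosDef) :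
    ∃ (u : Fin n → D) (m : Fin n → ℝ), (∀ i, u i ∈ Submodule.span ℝ (Set.range v)) ∧
      (∀ i l, ip (u i) (u l) = if i = l then 1 else 0) ∧
      (∀ i l, E (u i) (u l) = if i = l then m i else 0) := by
  classical
  -- step 1: whitening with the eigen-decomposition of the Gram matrix
  set G : Matrix (Fin n) (Fin n) ℝ := Matrix.of fun i l => ip (v i) (v l) with hG_def
  have hGh : G.IsHermitian := hG.1
  set lam : Fin n → ℝ := hGh.eigenvalues with hlam
  have hlam_pos : ∀ i, 0 < lam i := fun i => hG.eigenvalues_pos i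
  set U : Fin n → Fin n → ℝ := fun i => ⇑(hGh.eigenvectorBasis i) with hU
  -- whitened family `b_i = λ_i^{-1/2} Σ_l U_i(l) v_l`
  set cb : Fin n → Fin n → ℝ := fun i l => (Real.sqrt (lam i))⁻¹ * U i l with hcb
  set b : Fin n → D := fun i => ∑ l, cb i l • v l with hb
  have hb_mem : ∀ i, b i ∈ Submodule.span ℝ (Set.range v) := fun i =>
    Submodule.sum_mem _ fun l _ => Submodule.smul_mem _ _ (Submodule.subset_span (Set.mem_range_self l))
  have hbb : ∀ i l, ip (b i) (b l) = if i = l then 1 else 0 := by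
    intro i l
    have hcbi : cb i = (Real.sqrt (lam i))⁻¹ • U i := by funext l'; simp [hcb]
    have hcbl : cb l = (Real.sqrt (lam l))⁻¹ • U l := by funext l'; simp [hcb]
    have h := bilin_sum_smul_eq_dotProduct_mulVec ip v (cb i) (cb l)
    simp only [hb]
    rw [h, ← hG_def, hcbi, hcbl, smul_dotProduct, Matrix.mulVec_smul, dotProduct_smul, smul_eq_mul, smul_eq_mul]
    have h2 := (eigenvectorBasis_dotProduct hGh i l).2
    simp only [hU]
    rw [h2]
    split_ifs with hil
    · subst hil
      have hs : Real.sqrt (lam i) ^ 2 = lam i := Real.sq_sqrt (hlam_pos i).le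
      have hs0 : Real.sqrt (lam i) ≠ 0 := Real.sqrt_ne_zero'.mpr (hlam_pos i)
      field_simp
      rw [hlam] at hs ⊢
      linarith [hs]
    · ring
  -- step 2: diagonalise the whitened form matrix
  set A : Matrix (Fin n) (Fin n) ℝ := Matrix.of fun i l => E (b i) (b l) with hA_def
  have hAh : A.IsHermitian := by
    rw [Matrix.IsHermitian]
    ext i l
    rw [Matrix.conjTranspose_apply, star_trivial, hA_def, Matrix.of_apply, Matrix.of_apply, hE_symm]
  set W : Fin n → Fin n → ℝ := fun i => ⇑(hAh.eigenvectorBasis i) with hW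
  refine ⟨fun i => ∑ l, W i l • b l, hAh.eigenvalues, fun i => ?_, fun i l => ?_, fun i l => ?_⟩
  · exact Submodule.sum_mem _ fun l _ => Submodule.smul_mem _ _ (hb_mem l)
  · -- `ip(u_i,u_l) = W_i ⬝ᵥ (I *ᵥ W_l) = δ_il`
    rw [bilin_sum_smul_eq_dotProduct_mulVec ip b (W i) (W l)]
    have hI : (Matrix.of fun l l' => ip (b l) (b l')) = (1 : Matrix (Fin n) (Fin n) ℝ) := by
      ext l l'
      rw [Matrix.of_apply, hbb, Matrix.one_apply]
    rw [hI, Matrix.one_mulVec]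
    simp only [hW]
    exact (eigenvectorBasis_dotProduct hAh i l).1
  · rw [bilin_sum_smul_eq_dotProduct_mulVec E b (W i) (W l), ← hA_def]
    simp only [hW]
    exact (eigenvectorBasis_dotProduct hAh i l).2

/-! ## The bottom of the spectrum (Temple–Lehmann lower bounds with min–max a-priori information) -/

/-- **Cluster Temple–Lehmann LOWER bound (bottom of the spectrum), min–max a-priori information.**  The mirror image of
`clusterKatoTemple` for `-E`: `u` `ip`-orthonormal with Ritz data `m_i` and residual representers `r_i ⊥ u`, residual
Gram bound `ϱ`, and `n` vectors `χ_l` with `E ≥ θ·ip` on their joint orthogonal complement ("`λ_{n+1} ≥ θ`" counting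
from `1` at the bottom, the a-priori information `ρ ≤ λ_{n+1}` of the Lehmann–Goerisch method), `m_i ≤ m̄ < θ`; then every
`x ⊥ u₀ … u_{j−1}` has `E(x,x) ≥ (m̲ − ϱ/(θ − m̄))·ip(x,x)` whenever `m̲ ≤ m_i` for `i ≥ j` — Kato's lower bound
`λ_j ≥ m_j − ϱ/(θ − m_n)` robust inside the cluster; compare `DeflatedFormBound.deflatedFormBound_orthonormal`, whose
complement bound is required on the orthogonal complement of the TRIAL vectors instead.
[cite: Lehmann1963] [cite: Wunderlich2022, Thm. 6.8 with (6.19)] [cite: Kato1949, Lemma 2, Thm 1 (n = 1)]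
[cite: ReedSimonIV1978, Thm. XIII.5 (n = 1: Temple)] -/
theorem clusterTempleLehmann_bot (ip E : D →ₗ[ℝ] D →ₗ[ℝ] ℝ)
    (hip_symm : ∀ x y, ip x y = ip y x) (hip_nonneg : ∀ x, 0 ≤ ip x x) (hE_symm : ∀ x y, E x y = E y x)
    {n : ℕ} {θ : ℝ} (χ : Fin n → D) (hθ : ∀ y, (∀ l, ip (χ l) y = 0) → θ * ip y y ≤ E y y)
    (u r : Fin n → D) (m : Fin n → ℝ)
    (hon : ∀ i l, ip (u i) (u l) = if i = l then 1 else 0)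
    (hrepr : ∀ i y, E (u i) y = m i * ip (u i) y + ip (r i) y)
    (hru : ∀ i l, ip (r i) (u l) = 0)
    (hθm : ∀ i, m i < θ)
    {ϱ : ℝ} (hϱ : 0 ≤ ϱ) (hres : ∀ c : Fin n → ℝ, ∑ i, ∑ l, c i * c l * ip (r i) (r l) ≤ ϱ * ∑ i, c i ^ 2)
    {j : ℕ} {mhi mlo : ℝ} (hθhi : mhi < θ) (hlohi : mlo ≤ mhi) (hmhi : ∀ i, m i ≤ mhi)
    (hmlo : ∀ i : Fin n, j ≤ i.val → mlo ≤ m i)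
    (x : D) (hx : ∀ i : Fin n, i.val < j → ip (u i) x = 0) :
    (mlo - ϱ / (θ - mhi)) * ip x x ≤ E x x := by
  have hneg : ∀ x y, (-E) x y = -(E x y) := fun x y => by simp only [LinearMap.neg_apply]
  have h := clusterKatoTemple ip (-E) hip_symm hip_nonneg (fun x y => by rw [hneg, hneg, hE_symm]) (θ := -θ) χ
    (fun y hy => by rw [hneg]; linarith [hθ y hy]) u (fun i => -r i) (fun i => -m i) hon
    (fun i y => by rw [hneg, hrepr, map_neg, LinearMap.neg_apply]; ring)
    (fun i l => by rw [map_neg, LinearMap.neg_apply, hru, neg_zero]) (fun i => by linarith [hθm i]) hϱ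
    (fun c => by
      have e : ∑ i, ∑ l, c i * c l * ip (-r i) (-r l) = ∑ i, ∑ l, c i * c l * ip (r i) (r l) :=
        sum_congr rfl fun i _ => sum_congr rfl fun l _ => by
          simp only [map_neg, LinearMap.neg_apply, neg_neg]
      rw [e]; exact hres c)
    (j := j) (mhi := -mlo) (mlo := -mhi) (by linarith) (by linarith) (fun i => by linarith [hmhi i])
    (fun i hi => by linarith [hmlo i hi]) x hx
  rw [hneg] at h
  have e : -mlo + ϱ / (-mhi - -θ) = -(mlo - ϱ / (θ - mhi)) := by
    rw [show -mhi - -θ = θ - mhi by ring]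
    ring
  rw [e] at h
  linarith

/-! ## Courant–Fischer inside the trial space: the Ritz values are the min–max values of the span -/

/-- **Ritz values as min–max values of the trial space, upper half.**  For an `ip`-orthonormal `E`-diagonal family
`u` (Ritz data `m_i`), every `x` in the span of the `u_i` which is `ip`-orthogonal to `u_i`, `i < j`, has
`E(x,x) ≤ m̄·ip(x,x)` as soon as `m_i ≤ m̄` for `i ≥ j`: with the constraints `u₀ … u_{j−1}` the sup of the Rayleigh
quotient over the trial space is `≤ max_{i ≥ j} m_i` (`= m_j` for decreasingly ordered Ritz values).
[cite: GolubVanLoan2013, §8.1.1, Thm 8.1.2 (Courant–Fischer minimax theorem)] -/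
theorem rayleigh_le_of_mem_span_of_orthogonal (ip E : D →ₗ[ℝ] D →ₗ[ℝ] ℝ)
    {n : ℕ} (u : Fin n → D) (m : Fin n → ℝ)
    (hon : ∀ i l, ip (u i) (u l) = if i = l then 1 else 0)
    (hdiag : ∀ i l, E (u i) (u l) = if i = l then m i else 0)
    {j : ℕ} {mhi : ℝ} (hmhi : ∀ i : Fin n, j ≤ i.val → m i ≤ mhi)
    {x : D} (hx : x ∈ Submodule.span ℝ (Set.range u)) (hperp : ∀ i : Fin n, i.val < j → ip (u i) x = 0) :
    E x x ≤ mhi * ip x x := by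
  classical
  obtain ⟨c, rfl⟩ := Submodule.mem_span_range_iff_exists_fun ℝ |>.mp hx
  -- the coefficients are `c_i = ip(u_i, x)`, hence vanish for `i < j`
  have hc : ∀ i, ip (u i) (∑ l, c l • u l) = c i := by
    intro i
    rw [bilin_sum_smul_right]
    simp only [hon, mul_ite, mul_one, mul_zero, Finset.sum_ite_eq, Finset.mem_univ, if_true]
  have hc0 : ∀ i : Fin n, i.val < j → c i = 0 := fun i hi => by rw [← hc i]; exact hperp i hi
  have hE : E (∑ l, c l • u l) (∑ l, c l • u l) = ∑ i, m i * c i ^ 2 := by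
    rw [bilin_sum_smul_sum_smul]
    refine sum_congr rfl fun i _ => ?_
    simp only [hdiag, mul_ite, mul_zero, Finset.sum_ite_eq, Finset.mem_univ, if_true]
    ring
  have hip : ip (∑ l, c l • u l) (∑ l, c l • u l) = ∑ i, c i ^ 2 := by
    rw [bilin_sum_smul_sum_smul]
    refine sum_congr rfl fun i _ => ?_
    simp only [hon, mul_ite, mul_one, mul_zero, Finset.sum_ite_eq, Finset.mem_univ, if_true]
    ring
  rw [hE, hip, mul_sum]
  refine sum_le_sum fun i _ => ?_
  by_cases hij : i.val < j
  · rw [hc0 i hij]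
    simp
  · exact mul_le_mul_of_nonneg_right (hmhi i (not_lt.mp hij)) (sq_nonneg _)

/-- **Ritz values as min–max values of the trial space, lower half (sharpness).**  For an `ip`-orthonormal
`E`-diagonal family `u` with `m_i ≥ m̲` for `i ≤ j` (`j < n`) and ANY `j` linear constraints `χ_l`, there is an
`ip`-normalised `x` in the span of `u₀ … u_j` satisfying the constraints with `E(x,x) ≥ m̲`: no choice of `j` constraints
pushes the sup of the Rayleigh quotient over the trial space below `min_{i ≤ j} m_i` (`= m_j` for decreasingly ordered Ritz
values).  With `rayleigh_le_of_mem_span_of_orthogonal`: `inf_{j constraints} sup_{span u ∩ ⊥} E/ip = m_j`.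
[cite: GolubVanLoan2013, §8.1.1, Thm 8.1.2 (Courant–Fischer minimax theorem)] -/
theorem exists_rayleigh_ge_of_constraints (ip E : D →ₗ[ℝ] D →ₗ[ℝ] ℝ)
    {n : ℕ} (u : Fin n → D) (m : Fin n → ℝ)
    (hon : ∀ i l, ip (u i) (u l) = if i = l then 1 else 0)
    (hdiag : ∀ i l, E (u i) (u l) = if i = l then m i else 0)
    {j : ℕ} (hj : j < n) {mlo : ℝ} (hmlo : ∀ i : Fin n, i.val ≤ j → mlo ≤ m i)
    (χ : Fin j → D →ₗ[ℝ] ℝ) :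
    ∃ x ∈ Submodule.span ℝ (Set.range u), ip x x = 1 ∧ (∀ l, χ l x = 0) ∧ mlo ≤ E x x := by
  classical
  have hjn : j + 1 ≤ n := hj
  -- the first `j+1` trial vectors
  set w : Fin (j + 1) → D := fun k => u (Fin.castLE hjn k) with hw
  have hwon : ∀ k k', ip (w k) (w k') = if k = k' then 1 else 0 := by
    intro k k'
    simp only [hw, hon, (Fin.castLE_injective hjn).eq_iff]
  have hwdiag : ∀ k k', E (w k) (w k') = if k = k' then m (Fin.castLE hjn k) else 0 := by
    intro k k'
    simp only [hw, hdiag, (Fin.castLE_injective hjn).eq_iff]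
  -- a non-trivial combination of them annihilated by the `j` constraints
  have hker : LinearMap.ker (Matrix.mulVecLin
      (Matrix.of fun (l : Fin j) (k : Fin (j + 1)) => χ l (w k))) ≠ ⊥ := by
    apply LinearMap.ker_ne_bot_of_finrank_lt
    simp only [Module.finrank_fin_fun]
    omega
  obtain ⟨g, hg, hg0⟩ := (Submodule.ne_bot_iff _).mp hker
  rw [LinearMap.mem_ker, Matrix.mulVecLin_apply] at hg
  set x₀ : D := ∑ k, g k • w k with hx₀
  have hχ : ∀ l, χ l x₀ = 0 := by
    intro l
    have h := congr_fun hg l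
    rw [Pi.zero_apply, Matrix.mulVec, dotProduct] at h
    rw [hx₀, map_sum]
    simp only [map_smul, smul_eq_mul]
    calc ∑ k, g k * χ l (w k)
        = ∑ k, (Matrix.of fun (l : Fin j) (k : Fin (j + 1)) => χ l (w k)) l k * g k := by
          refine sum_congr rfl fun k _ => ?_
          rw [Matrix.of_apply]
          ring
      _ = 0 := h
  have hip₀ : ip x₀ x₀ = ∑ k, g k ^ 2 := by
    rw [hx₀, bilin_sum_smul_sum_smul]
    refine sum_congr rfl fun k _ => ?_
    simp only [hwon, mul_ite, mul_one, mul_zero, Finset.sum_ite_eq, Finset.mem_univ, if_true]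
    ring
  have hE₀ : E x₀ x₀ = ∑ k, m (Fin.castLE hjn k) * g k ^ 2 := by
    rw [hx₀, bilin_sum_smul_sum_smul]
    refine sum_congr rfl fun k _ => ?_
    simp only [hwdiag, mul_ite, mul_zero, Finset.sum_ite_eq, Finset.mem_univ, if_true]
    ring
  -- `σ = Σ g_k² > 0`
  have hσ : 0 < ∑ k, g k ^ 2 := by
    obtain ⟨k, hk⟩ : ∃ k, g k ≠ 0 := by
      by_contra h
      push Not at h
      exact hg0 (funext fun k => by rw [h k, Pi.zero_apply])
    exact lt_of_lt_of_le (by positivity) (Finset.single_le_sum (fun k _ => sq_nonneg (g k)) (mem_univ k))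
  have hEσ : mlo * ∑ k, g k ^ 2 ≤ E x₀ x₀ := by
    rw [hE₀, mul_sum]
    exact sum_le_sum fun k _ => mul_le_mul_of_nonneg_right
      (hmlo _ (by simpa [Fin.val_castLE] using Nat.lt_succ_iff.mp k.isLt)) (sq_nonneg _)
  -- normalise
  set s : ℝ := (Real.sqrt (∑ k, g k ^ 2))⁻¹ with hs
  have hs2 : s ^ 2 * ∑ k, g k ^ 2 = 1 := by
    rw [hs, inv_pow, Real.sq_sqrt hσ.le, inv_mul_cancel₀ hσ.ne']
  refine ⟨s • x₀, ?_, ?_, ?_, ?_⟩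
  · refine Submodule.smul_mem _ _ (Submodule.sum_mem _ fun k _ => Submodule.smul_mem _ _ ?_)
    exact Submodule.subset_span (Set.mem_range_self _)
  · simp only [map_smul, LinearMap.smul_apply, smul_eq_mul]
    rw [hip₀, ← mul_assoc, ← sq, hs2]
  · intro l
    rw [map_smul, smul_eq_mul, hχ l, mul_zero]
  · simp only [map_smul, LinearMap.smul_apply, smul_eq_mul]
    rw [← mul_assoc, ← sq]
    have h1 : s ^ 2 * (mlo * ∑ k, g k ^ 2) ≤ s ^ 2 * E x₀ x₀ := mul_le_mul_of_nonneg_left hEσ (sq_nonneg _)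
    calc mlo = s ^ 2 * (mlo * ∑ k, g k ^ 2) := by rw [mul_left_comm, hs2, mul_one]
      _ ≤ s ^ 2 * E x₀ x₀ := h1

/-- **Ritz diagonalisation with decreasingly ordered Ritz values.**  As `exists_orthonormal_formDiagonal`, with the Ritz values
sorted `m₀ ≥ m₁ ≥ … ≥ m_{n−1}` (so that `m_i ≤ m_j` for `i ≥ j`, the index convention of `clusterKatoTemple` and of
min–max values counted from the top). [cite: GolubVanLoan2013, §8.7.1, Cor. 8.7.2; §8.1.1, Thm 8.1.2] -/
theorem exists_orthonormal_formDiagonal_antitone (ip E : D →ₗ[ℝ] D →ₗ[ℝ] ℝ) (hE_symm : ∀ x y, E x y = E y x)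
    {n : ℕ} (v : Fin n → D) (hG : (Matrix.of fun i l => ip (v i) (v l)).PosDef) :
    ∃ (u : Fin n → D) (m : Fin n → ℝ), Antitone m ∧ (∀ i, u i ∈ Submodule.span ℝ (Set.range v)) ∧
      (∀ i l, ip (u i) (u l) = if i = l then 1 else 0) ∧
      (∀ i l, E (u i) (u l) = if i = l then m i else 0) := by
  classical
  obtain ⟨u, m, hmem, hon, hdiag⟩ := exists_orthonormal_formDiagonal ip E hE_symm v hG
  -- `m ∘ sort` is monotone, hence `i ↦ m (sort (rev i))` is antitone
  set τ : Fin n → Fin n := fun i => Tuple.sort m (Fin.rev i) with hτ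
  have hτ_inj : Function.Injective τ := by
    intro i l h
    have h' := (Tuple.sort m).injective h
    exact Fin.rev_injective h'
  refine ⟨fun i => u (τ i), fun i => m (τ i), ?_, fun i => hmem _, fun i l => ?_, fun i l => ?_⟩
  · intro i l hil
    have hmono := Tuple.monotone_sort m
    have h : Fin.rev l ≤ Fin.rev i := Fin.rev_le_rev.mpr hil
    exact hmono h
  · simp only [hon, hτ_inj.eq_iff]
  · simp only [hdiag, hτ_inj.eq_iff]

end Literature.Analysis.OperatorTheory.ClusterKatoTemple
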